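import Summits.Ventures.Crystal3D.Theorems.StickyWulffConstantTextureLiminfCellFlux
import Summits.Ventures.Crystal3D.Theorems.StickyWulffConstantTextureLiminfTexShadowSplitDefs
import HarnessLib

/-!
# TexShadow — the CHARGE SIDE of the T/F glue for co-axial plate pairs: admissible tables of a co-axial fcc pair charge the unit slice at
# most `½·sin θ·πρ²` (lane T, crux `TextureLiminf`, stmt-Ventures-19483; line `TexShadow` v6.16; on-reach sub-stubs O2/O3, cf-p1 (xlv))

HONEST FRAMING. Venture `Summits/Ventures/Crystal3D` (cell `crystal3d-full`), helper `--supports` the crux `TextureLiminf`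
(stmt-Ventures-19483) of `route-Ventures-StickyWulffConstant`, registered line `TexShadow`.  Rung credit only; F-C1 not moved.  Pure proofs.

The cell inequality `BilayerWallAt` books the wall charge as `Σ'_{ij} c i j · |slice ∩ laySlab₁ i ∩ laySlab₂ j|` over the unit slice
`wallSlice ρ = {0 ≤ q₂ ≤ 1, q₀² + q₁² ≤ ρ²}`.  To import lane F's `CoaxialTwoSlabAdhesion` (which pays `½·√(1−⟪Le₃,e₃⟫²)·πρ²` for ITS shared
frame `L`) into the co-axial on-reach classes, T must show its admissible tables never charge more:
* `tsum_charge_le_cap` — a table with `0 ≤ c ≤ κ` charges at most `κ·πρ²` (`charge_le_flux` with constant fluxes + the slab partition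
  `measure_eq_tsum_inter_laySlab` + `volume_wallSlice`);
* `cap_of_admissible` — an ADMISSIBLE table (`BilayerChargeAdmissible A₁ A₂ c m`) all of whose bilayer-frame pairs are either EQUAL linear
  lattices or CO-AXIAL with every shared axis `m'` satisfying `√(1−⟪m′,e₃⟫²) ≤ θ` is capped by `½·θ` (equal ⇒ `c = 0`; co-axial distinct ⇒
  `c ≤ ½√(1−⟪m_ij,e₃⟫²) ≤ ½θ`; the axis-uniqueness `coaxial_axis_eq_or_eq_neg` of lanes G/P supplies the hypothesis for fcc|fcc pairs);
* **`tsum_charge_le_half_sin`** — hence such a table charges the unit slice at most `½·θ·πρ²`.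
WHAT THIS IS NOT: not the inner-face count `φπρ² ≤ ½·innerBonds + Cρ` (the other half of the glue), not the O2/O3 closers; F-C1 not moved.
-/

noncomputable section

open scoped BigOperators InnerProductSpace ENNReal
open MeasureTheory

namespace Summit.Ventures.Crystal3D.Theorems

open Summit.Ventures.Crystal3D.Cruxes.TextureLiminf.TexShadow (E3 e₃ laySlab CoAx SharedAxis fccRef BilayerChargeAdmissible)

/-- Slicing a finite-volume set by the slabs of one frame, in `ℝ` with a constant weight: `Σ' i κ·|S ∩ slab i| = κ·|S|`. -/
theorem tsum_const_mul_volume_inter_laySlab (L : E3 ≃ₗᵢ[ℝ] E3) (s : E3) (κ : ℝ) (S : Set E3) (hS : MeasurableSet S)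
    (hSfin : volume S ≠ ⊤) :
    ∑' i : ℤ, κ * (volume (S ∩ laySlab L s i)).toReal = κ * (volume S).toReal := by
  rw [tsum_mul_left]
  congr 1
  have hfin : ∀ i : ℤ, volume (S ∩ laySlab L s i) ≠ ⊤ := fun i =>
    ne_top_of_le_ne_top hSfin (measure_mono Set.inter_subset_left)
  rw [← ENNReal.tsum_toReal_eq hfin, ← measure_eq_tsum_inter_laySlab L s S hS]

/-- **A table capped by `κ` charges the unit slice at most `κ·πρ²`.** -/
theorem tsum_charge_le_cap (L₁ L₂ : E3 ≃ₗᵢ[ℝ] E3) (s₁ s₂ : E3) (c : ℤ → ℤ → ℝ) {κ : ℝ} (hκ : 0 ≤ κ)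
    (hc0 : ∀ i j, 0 ≤ c i j) (hcap : ∀ i j, c i j ≤ κ) {ρ : ℝ} (hρ : 0 ≤ ρ) :
    ∑' ij : ℤ × ℤ, c ij.1 ij.2 * (volume (wallSlice ρ ∩ laySlab L₁ s₁ ij.1 ∩ laySlab L₂ s₂ ij.2)).toReal ≤
      κ * (Real.pi * ρ ^ 2) := by
  have hS := measurableSet_wallSlice ρ
  have hvol : volume (wallSlice ρ) = ENNReal.ofReal (Real.pi * ρ ^ 2) := volume_wallSlice ρ hρ
  have hSfin : volume (wallSlice ρ) ≠ ⊤ := by rw [hvol]; exact ENNReal.ofReal_ne_top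
  have h := charge_le_flux L₁ L₂ s₁ s₂ (fun _ => κ) (fun _ => κ) c κ (fun _ => hκ) (fun _ => le_rfl) (fun _ => hκ)
    (fun _ => le_rfl) hc0 (fun i j => by have := hcap i j; linarith) (wallSlice ρ) hS hSfin
  rw [tsum_const_mul_volume_inter_laySlab L₁ s₁ κ _ hS hSfin, tsum_const_mul_volume_inter_laySlab L₂ s₂ κ _ hS hSfin, hvol,
    ENNReal.toReal_ofReal (by positivity)] at h
  linarith

/-- **Admissible tables of an equal-or-co-axial pair are capped by `½·θ`**: if every bilayer-frame pair has equal linear lattices or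
is co-axial with all its shared axes `m′` at `√(1−⟪m′,e₃⟫²) ≤ θ`, then `c i j ≤ ½·θ`. -/
theorem cap_of_admissible {A₁ A₂ : ℤ → (E3 ≃ₗᵢ[ℝ] E3)} {c : ℤ → ℤ → ℝ} {m : ℤ → ℤ → E3}
    (hadm : BilayerChargeAdmissible A₁ A₂ c m) {θ : ℝ} (hθ : 0 ≤ θ)
    (hax : ∀ i j, A₁ i '' fccRef = A₂ j '' fccRef ∨
      (CoAx (A₁ i) (A₂ j) ∧ ∀ m' : E3, SharedAxis m' (A₁ i) (A₂ j) → Real.sqrt (1 - ⟪m', e₃⟫_ℝ ^ 2) ≤ θ)) :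
    ∀ i j, c i j ≤ 1 / 2 * θ := by
  intro i j
  rcases hax i j with heq | ⟨hco, hsin⟩
  · rw [hadm.2.2.2 i j heq]; positivity
  · by_cases heq : A₁ i '' fccRef = A₂ j '' fccRef
    · rw [hadm.2.2.2 i j heq]; positivity
    · obtain ⟨hsh, hc⟩ := hadm.2.2.1 i j hco heq
      exact hc.trans (by have := hsin (m i j) hsh; nlinarith)

/-- **Hence an admissible table of an equal-or-co-axial pair charges the unit slice at most `½·θ·πρ²`.** -/
theorem tsum_charge_le_half_sin (L₁ L₂ : E3 ≃ₗᵢ[ℝ] E3) (s₁ s₂ : E3) {A₁ A₂ : ℤ → (E3 ≃ₗᵢ[ℝ] E3)} {c : ℤ → ℤ → ℝ}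
    {m : ℤ → ℤ → E3} (hadm : BilayerChargeAdmissible A₁ A₂ c m) {θ : ℝ} (hθ : 0 ≤ θ)
    (hax : ∀ i j, A₁ i '' fccRef = A₂ j '' fccRef ∨
      (CoAx (A₁ i) (A₂ j) ∧ ∀ m' : E3, SharedAxis m' (A₁ i) (A₂ j) → Real.sqrt (1 - ⟪m', e₃⟫_ℝ ^ 2) ≤ θ))
    {ρ : ℝ} (hρ : 0 ≤ ρ) :
    ∑' ij : ℤ × ℤ, c ij.1 ij.2 * (volume (wallSlice ρ ∩ laySlab L₁ s₁ ij.1 ∩ laySlab L₂ s₂ ij.2)).toReal ≤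
      1 / 2 * θ * (Real.pi * ρ ^ 2) :=
  tsum_charge_le_cap L₁ L₂ s₁ s₂ c (by positivity) hadm.1 (cap_of_admissible hadm hθ hax) hρ

end Summit.Ventures.Crystal3D.Theorems

end
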